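import Literature.Probability.Percolation.QuadCrossingReparam
import Literature.Probability.Percolation.QuadCrossingSpaceProofs
import HarnessLib

/-!
# Crossing events depend only on the carrier and the four sides

Stub S3d `stub_crossedEvent_eq_of_sides` of the line `registered` of crux `Z2LimitsSymmetric`
(stmt-CriticalPhenomena-14827), route `CardyMeckeFlip`, sub-problem `CardyFormulaZ2`.

In the Schramm–Smirnov space `ℋ_D = QuadConfig D` of closed `<`-lower sets of PARAMETRISED quads
the crossing event `⊞_Q = {S | Q ∈ S}` a priori depends on the parametrisation of `Q`.  It does
not: it depends only on the carrier `[Q]` and the four sides `∂₀Q, …, ∂₃Q` (for `D` open; the stub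
is the case `D = ℂ`).

* `strictlyDominated_reparam_right_iff`, `reparam_strictlyDominated_iff`: `Q₁ < Q₂ ∘ k ↔ Q₁ < Q₂`
  and `Q₁ ∘ k < Q₂ ↔ Q₁ < Q₂` for a side-preserving self-homeomorphism `k` of the square
  (`P ↦ P ∘ k` is a self-homeomorphism of `𝒬_D` fixing the relation `≤`, hence also its interior
  `<`; `QuadCrossingReparam` has the two-sided version `strictlyDominated_reparam_iff`).
* `reparam_mem` (REPARAMETRISATION INVARIANCE of closed lower sets, `D` open): `Q ∈ S → Q ∘ k ∈ S`.
  Quads `Q' < Q` accumulate at `Q` (`Quad.exists_strictlyDominated_dist_lt`); the quads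
  `Q' ∘ k < Q` lie in the lower set `S` and accumulate at `Q ∘ k` (`P ↦ P ∘ k` is an isometry,
  `Quad.dist_reparam_reparam`), and `S` is closed.  So `⊞_{Q ∘ k} = ⊞_Q` (`crossedEvent_reparam`).
* `exists_sidePreserving_eq_reparam`: two quads with the same carrier and the same four sides
  differ by a side-preserving self-homeomorphism of the square (each is a homeomorphism of the
  compact square onto the common carrier, `Continuous.isClosedEmbedding`; the composite
  `k = P⁻¹ ∘ P'` preserves each side because `P`, `P'` are injective and map that side of the
  square onto the same set).
* `stub_crossedEvent_eq_of_sides`: hence `⊞_{P'} = ⊞_P`.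

## References

* O. Schramm, S. Smirnov, *On the scaling limits of planar percolation*, Ann. Probab. 39 (2011),
  1768–1814, §1.3 ("We introduce some redundancy …"). [SchrammSmirnov2011]
-/

noncomputable section

open Set Filter Metric Topology
open scoped unitInterval
open Literature.Probability.Percolation Literature.Probability.Percolation.QuadCrossing

namespace Summit.CriticalPhenomena.CardyFormulaZ2.Cruxes.Z2LimitsSymmetric

variable {D : Set ℂ}

/-! ### `<` is invariant under side-preserving reparametrisation of either quad -/

/-- `≤` is unchanged by a side-preserving reparametrisation of the larger quad (crossings of
`Q ∘ k` are the crossings of `Q`). -/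
theorem dominated_reparam_right_iff {Q₁ Q₂ : Quad D} {k : I × I ≃ₜ I × I}
    (hk : Quad.SidePreserving k) :
    Quad.Dominated Q₁ (Q₂.reparam k) ↔ Quad.Dominated Q₁ Q₂ := by
  simp only [Quad.Dominated, Quad.isCrossing_reparam_iff _ hk]

/-- **`<` is unchanged by a side-preserving reparametrisation of the larger quad**: the
self-homeomorphism `(P, P') ↦ (P, P' ∘ k)` of `𝒬_D × 𝒬_D` maps `{(P, P') | P ≤ P'}` onto itself,
hence also its interior `{(P, P') | P < P'}`. -/
theorem strictlyDominated_reparam_right_iff {Q₁ Q₂ : Quad D} {k : I × I ≃ₜ I × I}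
    (hk : Quad.SidePreserving k) :
    Quad.StrictlyDominated Q₁ (Q₂.reparam k) ↔ Quad.StrictlyDominated Q₁ Q₂ := by
  set Φ : Quad D × Quad D ≃ₜ Quad D × Quad D :=
    (Homeomorph.refl (Quad D)).prodCongr (Quad.reparamHomeomorph k) with hΦ
  have hset : Φ ⁻¹' {p : Quad D × Quad D | Quad.Dominated p.1 p.2} =
      {p | Quad.Dominated p.1 p.2} := by
    ext p
    simp only [mem_preimage, mem_setOf_eq]
    show Quad.Dominated p.1 (p.2.reparam k) ↔ _
    exact dominated_reparam_right_iff hk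
  show Φ (Q₁, Q₂) ∈ interior {p : Quad D × Quad D | Quad.Dominated p.1 p.2} ↔
    (Q₁, Q₂) ∈ interior {p : Quad D × Quad D | Quad.Dominated p.1 p.2}
  rw [← mem_preimage, Φ.preimage_interior, hset]

/-- **`<` is unchanged by a side-preserving reparametrisation of the smaller quad**:
`Q₁ ∘ k < Q₂ ↔ Q₁ ∘ k < Q₂ ∘ k ↔ Q₁ < Q₂`. -/
theorem reparam_strictlyDominated_iff {Q₁ Q₂ : Quad D} {k : I × I ≃ₜ I × I}
    (hk : Quad.SidePreserving k) :
    Quad.StrictlyDominated (Q₁.reparam k) Q₂ ↔ Quad.StrictlyDominated Q₁ Q₂ := by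
  rw [← strictlyDominated_reparam_right_iff (Q₁ := Q₁.reparam k) (Q₂ := Q₂) hk,
    Quad.strictlyDominated_reparam_iff hk]

/-! ### Reparametrisation invariance of closed lower sets -/

/-- **Reparametrisation invariance of closed lower sets** (`D` open): if `Q ∈ S` then
`Q ∘ k ∈ S` for every side-preserving `k`.  Quads `Q' < Q` arbitrarily close to `Q` exist
(`Quad.exists_strictlyDominated_dist_lt`); then `Q' ∘ k < Q`, so `Q' ∘ k ∈ S`, and
`d(Q ∘ k, Q' ∘ k) = d(Q, Q')`, so `Q ∘ k` lies in the closure of `S`, which is `S`. -/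
theorem reparam_mem (hD : IsOpen D) {k : I × I ≃ₜ I × I} (hk : Quad.SidePreserving k)
    (S : QuadConfig D) {Q : Quad D} (hQ : Q ∈ S) : Q.reparam k ∈ S := by
  have h : Q.reparam k ∈ closure (S : Set (Quad D)) := by
    rw [Metric.mem_closure_iff]
    intro ε hε
    obtain ⟨Q', hQ'd, hQ'lt⟩ := Quad.exists_strictlyDominated_dist_lt hD Q hε
    refine ⟨Q'.reparam k, S.isLowerQuadSet hQ ((reparam_strictlyDominated_iff hk).2 hQ'lt), ?_⟩
    rw [dist_comm, Quad.dist_reparam_reparam]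
    exact hQ'd
  rwa [S.isClosed.closure_eq] at h

/-- Hence **`⊞_{Q ∘ k} = ⊞_Q`** for every side-preserving `k` (`D` open): apply `reparam_mem` to
`k` and to `k⁻¹`. -/
theorem crossedEvent_reparam (hD : IsOpen D) {k : I × I ≃ₜ I × I} (hk : Quad.SidePreserving k)
    (Q : Quad D) : QuadConfig.crossedEvent (Q.reparam k) = QuadConfig.crossedEvent Q := by
  ext S
  simp only [QuadConfig.mem_crossedEvent]
  constructor
  · intro h
    simpa using reparam_mem hD hk.symm S h
  · exact reparam_mem hD hk S

/-! ### Quads with the same carrier and sides differ by a side-preserving reparametrisation -/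

/-- For an injective parametrisation `P`, membership of `P q` in `P '' C` is membership of `q` in
`C`; transported along `P ∘ k = P'` and `P' '' C = P '' C` this reads `k p ∈ C ↔ p ∈ C`. -/
theorem mem_iff_of_image_eq {P P' : Quad D} {k : I × I → I × I} (hk : ∀ p, P (k p) = P' p)
    {C : Set (I × I)} (hC : P' '' C = P '' C) (p : I × I) : k p ∈ C ↔ p ∈ C := by
  rw [← P.injective_toFun.mem_set_image (a := k p) (s := C),
    ← P'.injective_toFun.mem_set_image (a := p) (s := C), hk p, hC]

/-- **Two quads with the same carrier and the same four sides differ by a side-preserving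
reparametrisation of the square.**  Both `P` and `P'` are continuous injections of the compact
square into the Hausdorff plane, hence homeomorphisms onto the common carrier
(`Continuous.isClosedEmbedding`, `IsEmbedding.toHomeomorph`); `k := P⁻¹ ∘ P'` is a
self-homeomorphism of the square with `P ∘ k = P'`, and it maps each side of the square onto
itself because `P` and `P'` map that side injectively onto the same set (`mem_iff_of_image_eq`). -/
theorem exists_sidePreserving_eq_reparam {P P' : Quad D} (hc : P'.carrier = P.carrier)
    (h0 : P'.side 0 = P.side 0) (h1 : P'.side 1 = P.side 1) (h2 : P'.side 2 = P.side 2)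
    (h3 : P'.side 3 = P.side 3) :
    ∃ k : I × I ≃ₜ I × I, Quad.SidePreserving k ∧ P' = P.reparam k := by
  -- the two parametrisations as homeomorphisms of the square onto the common carrier
  have hemb : IsEmbedding (P : I × I → ℂ) :=
    (P.continuous_toFun.isClosedEmbedding P.injective_toFun).toIsEmbedding
  have hemb' : IsEmbedding (P' : I × I → ℂ) :=
    (P'.continuous_toFun.isClosedEmbedding P'.injective_toFun).toIsEmbedding
  have hc' : range (P' : I × I → ℂ) = range (P : I × I → ℂ) := hc
  set k : I × I ≃ₜ I × I :=
    hemb'.toHomeomorph.trans ((Homeomorph.setCongr hc').trans hemb.toHomeomorph.symm) with hk_def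
  -- `P ∘ k = P'`
  have hk : ∀ p, P (k p) = P' p := fun p => by
    have h₁ : (hemb.toHomeomorph (k p) : ℂ) = P (k p) := hemb.toHomeomorph_apply_coe (k p)
    have h₂ : hemb.toHomeomorph (k p) = Homeomorph.setCongr hc' (hemb'.toHomeomorph p) := by
      rw [hk_def, Homeomorph.trans_apply, Homeomorph.trans_apply, Homeomorph.apply_symm_apply]
    have h₃ : ((Homeomorph.setCongr hc' (hemb'.toHomeomorph p) : range (P : I × I → ℂ)) : ℂ) =
        (hemb'.toHomeomorph p : ℂ) := rfl
    rw [← h₁, h₂, h₃, hemb'.toHomeomorph_apply_coe]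
  -- the four sides, as images of the sides of the square
  have h0' : P' '' {z : I × I | z.1 = 0} = P '' {z : I × I | z.1 = 0} := h0
  have h1' : P' '' {z : I × I | z.2 = 0} = P '' {z : I × I | z.2 = 0} := h1
  have h2' : P' '' {z : I × I | z.1 = 1} = P '' {z : I × I | z.1 = 1} := h2
  have h3' : P' '' {z : I × I | z.2 = 1} = P '' {z : I × I | z.2 = 1} := h3
  refine ⟨k, ⟨fun p => ?_, fun p => ?_, fun p => ?_, fun p => ?_⟩, Quad.ext fun p => (hk p).symm⟩
  · exact mem_iff_of_image_eq hk h0' p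
  · exact mem_iff_of_image_eq hk h1' p
  · exact mem_iff_of_image_eq hk h2' p
  · exact mem_iff_of_image_eq hk h3' p

/-! ### The stub -/

/-- **S3d `stub_crossedEvent_eq_of_sides`: crossing events depend only on the carrier and the
four sides.**  Two quads of the plane with the same carrier and the same sides differ by a
side-preserving reparametrisation `k` of the square (`exists_sidePreserving_eq_reparam`), and
`⊞_{P ∘ k} = ⊞_P` (`crossedEvent_reparam`: closed lower sets are invariant under side-preserving
reparametrisation). -/
theorem stub_crossedEvent_eq_of_sides : open Literature.Probability.Percolation.QuadCrossing in ∀ (P P' : Quad (Set.univ : Set ℂ)), P'.carrier = P.carrier → P'.side 0 = P.side 0 → P'.side 1 = P.side 1 → P'.side 2 = P.side 2 → P'.side 3 = P.side 3 → QuadConfig.crossedEvent P' = QuadConfig.crossedEvent P := by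
  intro P P' hc h0 h1 h2 h3
  obtain ⟨k, hk, rfl⟩ := exists_sidePreserving_eq_reparam hc h0 h1 h2 h3
  exact crossedEvent_reparam isOpen_univ hk P

end Summit.CriticalPhenomena.CardyFormulaZ2.Cruxes.Z2LimitsSymmetric

end
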